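import Summits.CriticalPhenomena.PercolationContinuityZ3.Theorems.PercNearOneGluingNoHeavyLowerTailFourCopyHubExpect
import Summits.CriticalPhenomena.PercolationContinuityZ3.Theorems.PercNearOneGluingNoHeavyLowerTailE3GroupSepAlphaGlueRows
import HarnessLib

/-!
# `NoHeavyLowerTail` (stmt-CriticalPhenomena-4575) — FOUR-copy switching certificates, VI: the target `α` and the
# bridge from the finitary conclusion to the measure-level row `AlphaRow`

Support file (prover prim-ineq-prove-3 gen 8; `--supports stmt-CriticalPhenomena-4575`).  No named facts, no sorries.

The four-point row `α = E₃(U[a|bc], U[ab|c], U[acy|b])` (`AlphaRow` of `…E3GroupSepAlphaGlueRows`, terminals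
`a b c y ↦ 0 1 2 3`) as a `E3Target` of part V on four-terminal types, and the transfer of the finitary conclusion of
`e3_nonneg_of_hubCert` (with `D = univ`, `p = w`) to `sahiE3 (prodBernoulli w)` of the three link events
(`alphaRow_of_PrW`): type events are `openConn` unions (`jn_ftype_iff`), `PrW univ` is the law of all pairs
(`prodBernoulli_real_eq_PrW_univ`).
-/

noncomputable section

namespace Summit.CriticalPhenomena.PercolationContinuityZ3.Theorems

namespace FourCopyHub

open Finset MeasureTheory Literature.Probability.Percolation Literature.Probability.Percolation.DecisionTree
open Literature.Probability.Percolation.Gladkov Literature.Probability.LatticeModels ThreePointLB GroupThreePointLB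
open FourPointAtoms SwitchRelax
open scoped Classical

/-- The target `α`: `A = {a~b ∨ a~c}`, `B = {c~a ∨ c~b}`, `C = {b~a ∨ b~c ∨ b~y}` (terminals `a,b,c,y = 0,1,2,3`). [this work] -/
def alphaTarget : E3Target where
  EA := fun t => jn t 0 1 || jn t 0 2
  EB := fun t => jn t 0 2 || jn t 1 2
  EC := fun t => jn t 0 1 || jn t 1 2 || jn t 1 3

section Bridge

variable {V : Type} [Fintype V]

/-- Terminal connections read off the type of a configuration placed at `![a,b,c,y]`. [this work] -/
theorem jn_ftype_vec_iff (a b c y : V) (S : Finset (Sym2 V)) (i j : Fin 4) :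
    jn (ftype (![a, b, c, y]) S) i j = true ↔ (↑S : Set (Sym2 V)) ∈ openConn ((![a, b, c, y]) i) ((![a, b, c, y]) j) := by
  rw [jn_ftype_iff, ← mem_conn_iff_mem_cl]; rfl

/-- The three link events of `α` on configurations of all pairs. [this work] -/
theorem mem_evT_alpha (a b c y : V) (S : Finset (Sym2 V)) :
    (S ∈ evT (![a, b, c, y]) alphaTarget.EA ↔ (↑S : Set (Sym2 V)) ∈ openConn a b ∪ openConn a c) ∧
    (S ∈ evT (![a, b, c, y]) alphaTarget.EB ↔ (↑S : Set (Sym2 V)) ∈ openConn a c ∪ openConn b c) ∧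
    (S ∈ evT (![a, b, c, y]) alphaTarget.EC ↔ (↑S : Set (Sym2 V)) ∈ openConn a b ∪ openConn b c ∪ openConn y b) := by
  have sy : ∀ u v : V, (↑S : Set (Sym2 V)) ∈ openConn u v ↔ (↑S : Set (Sym2 V)) ∈ openConn v u :=
    fun u v => ⟨fun h => SimpleGraph.Reachable.symm h, fun h => SimpleGraph.Reachable.symm h⟩
  refine ⟨?_, ?_, ?_⟩
  · simp only [evT, alphaTarget, Set.mem_setOf_eq, Bool.or_eq_true, jn_ftype_vec_iff, Set.mem_union,
      Matrix.cons_val_zero, Matrix.cons_val_one, Matrix.cons_val]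
  · simp only [evT, alphaTarget, Set.mem_setOf_eq, Bool.or_eq_true, jn_ftype_vec_iff, Set.mem_union,
      Matrix.cons_val_zero, Matrix.cons_val_one, Matrix.cons_val]
  · simp only [evT, alphaTarget, Set.mem_setOf_eq, Bool.or_eq_true, jn_ftype_vec_iff, Set.mem_union,
      Matrix.cons_val_zero, Matrix.cons_val_one, Matrix.cons_val]
    constructor
    · rintro ((h | h) | h); exacts [Or.inl (Or.inl h), Or.inl (Or.inr h), Or.inr ((sy _ _).1 h)]
    · rintro ((h | h) | h); exacts [Or.inl (Or.inl h), Or.inl (Or.inr h), Or.inr ((sy _ _).1 h)]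

/-- **Bridge.**  If the finitary `E₃` expression of the `α` target is nonnegative for all placements and coordinate
probabilities, then `AlphaRow` holds. [this work] -/
theorem alphaRow_of_PrW
    (h : ∀ {V : Type} [Fintype V] [DecidableEq V] (τ : Fin 4 → V) (p : Sym2 V → ℝ),
      (∀ e, 0 ≤ p e) → (∀ e, p e ≤ 1) →
      0 ≤ 2 * PrW Finset.univ p (evT τ fun t => alphaTarget.EA t && alphaTarget.EB t && alphaTarget.EC t) +
        PrW Finset.univ p (evT τ alphaTarget.EA) * PrW Finset.univ p (evT τ alphaTarget.EB) *
          PrW Finset.univ p (evT τ alphaTarget.EC) -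
        PrW Finset.univ p (evT τ alphaTarget.EA) * PrW Finset.univ p (evT τ fun t => alphaTarget.EB t && alphaTarget.EC t) -
        PrW Finset.univ p (evT τ alphaTarget.EB) * PrW Finset.univ p (evT τ fun t => alphaTarget.EA t && alphaTarget.EC t) -
        PrW Finset.univ p (evT τ alphaTarget.EC) * PrW Finset.univ p (evT τ fun t => alphaTarget.EA t && alphaTarget.EB t)) :
    AlphaRow := by
  intro V _ w a b c y
  classical
  have hp0 : ∀ e, 0 ≤ (w e : ℝ) := fun e => (w e).2.1
  have hp1 : ∀ e, (w e : ℝ) ≤ 1 := fun e => (w e).2.2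
  have key := h (![a, b, c, y]) (fun e => (w e : ℝ)) hp0 hp1
  -- the three events of `AlphaRow` as `openConn` unions
  set A : Set (BondConfig V) := {ω | ∃ x ∈ ({a} : Set V), ∃ z ∈ ({b, c} : Set V), (openGraph ω).Reachable x z} with hA
  set B : Set (BondConfig V) := {ω | ∃ x ∈ ({a, b} : Set V), ∃ z ∈ ({c} : Set V), (openGraph ω).Reachable x z} with hB
  set C : Set (BondConfig V) := {ω | ∃ x ∈ ({a, c, y} : Set V), ∃ z ∈ ({b} : Set V), (openGraph ω).Reachable x z} with hC
  have eA : A = openConn a b ∪ openConn a c := by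
    rw [hA]; ext ω
    simp only [Set.mem_setOf_eq, Set.mem_singleton_iff, Set.mem_insert_iff, Set.mem_union, openConn]
    constructor
    · rintro ⟨x, rfl, z, hz, h⟩; rcases hz with rfl | rfl; exacts [Or.inl h, Or.inr h]
    · rintro (h | h); exacts [⟨a, rfl, b, Or.inl rfl, h⟩, ⟨a, rfl, c, Or.inr rfl, h⟩]
  have eB : B = openConn a c ∪ openConn b c := by
    rw [hB]; ext ω
    simp only [Set.mem_setOf_eq, Set.mem_singleton_iff, Set.mem_insert_iff, Set.mem_union, openConn]
    constructor
    · rintro ⟨x, hx, z, rfl, h⟩; rcases hx with rfl | rfl; exacts [Or.inl h, Or.inr h]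
    · rintro (h | h); exacts [⟨a, Or.inl rfl, c, rfl, h⟩, ⟨b, Or.inr rfl, c, rfl, h⟩]
  have eC : C = openConn a b ∪ openConn b c ∪ openConn y b := by
    rw [hC]; ext ω
    simp only [Set.mem_setOf_eq, Set.mem_singleton_iff, Set.mem_insert_iff, Set.mem_union, openConn]
    constructor
    · rintro ⟨x, hx, z, rfl, h⟩
      rcases hx with rfl | rfl | rfl
      exacts [Or.inl (Or.inl h), Or.inl (Or.inr (SimpleGraph.Reachable.symm h)), Or.inr h]
    · rintro ((h | h) | h)
      exacts [⟨a, Or.inl rfl, b, rfl, h⟩, ⟨c, Or.inr (Or.inl rfl), b, rfl, SimpleGraph.Reachable.symm h⟩,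
        ⟨y, Or.inr (Or.inr rfl), b, rfl, h⟩]
  rw [eA, eB, eC, sahiE3_def]
  -- transfer each probability to `PrW univ`
  have M := fun S : Finset (Sym2 V) => mem_evT_alpha a b c y S
  have t1 : (prodBernoulli w).real ((openConn a b ∪ openConn a c) ∩ (openConn a c ∪ openConn b c) ∩
      (openConn a b ∪ openConn b c ∪ openConn y b)) =
      PrW Finset.univ (fun e => (w e : ℝ))
        (evT (![a, b, c, y]) fun t => alphaTarget.EA t && alphaTarget.EB t && alphaTarget.EC t) :=
    prodBernoulli_real_eq_PrW_univ w fun S => by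
      have h := M S; simp only [evT, Set.mem_setOf_eq, Bool.and_eq_true] at h ⊢
      rw [Set.mem_inter_iff, Set.mem_inter_iff, ← h.1, ← h.2.1, ← h.2.2]
  have tA : (prodBernoulli w).real (openConn a b ∪ openConn a c) =
      PrW Finset.univ (fun e => (w e : ℝ)) (evT (![a, b, c, y]) alphaTarget.EA) :=
    prodBernoulli_real_eq_PrW_univ w fun S => (M S).1
  have tB : (prodBernoulli w).real (openConn a c ∪ openConn b c) =
      PrW Finset.univ (fun e => (w e : ℝ)) (evT (![a, b, c, y]) alphaTarget.EB) :=
    prodBernoulli_real_eq_PrW_univ w fun S => (M S).2.1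
  have tC : (prodBernoulli w).real (openConn a b ∪ openConn b c ∪ openConn y b) =
      PrW Finset.univ (fun e => (w e : ℝ)) (evT (![a, b, c, y]) alphaTarget.EC) :=
    prodBernoulli_real_eq_PrW_univ w fun S => (M S).2.2
  have tBC : (prodBernoulli w).real ((openConn a c ∪ openConn b c) ∩ (openConn a b ∪ openConn b c ∪ openConn y b)) =
      PrW Finset.univ (fun e => (w e : ℝ)) (evT (![a, b, c, y]) fun t => alphaTarget.EB t && alphaTarget.EC t) :=
    prodBernoulli_real_eq_PrW_univ w fun S => by
      have h := M S; simp only [evT, Set.mem_setOf_eq, Bool.and_eq_true] at h ⊢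
      rw [Set.mem_inter_iff, ← h.2.1, ← h.2.2]
  have tAC : (prodBernoulli w).real ((openConn a b ∪ openConn a c) ∩ (openConn a b ∪ openConn b c ∪ openConn y b)) =
      PrW Finset.univ (fun e => (w e : ℝ)) (evT (![a, b, c, y]) fun t => alphaTarget.EA t && alphaTarget.EC t) :=
    prodBernoulli_real_eq_PrW_univ w fun S => by
      have h := M S; simp only [evT, Set.mem_setOf_eq, Bool.and_eq_true] at h ⊢
      rw [Set.mem_inter_iff, ← h.1, ← h.2.2]
  have tAB : (prodBernoulli w).real ((openConn a b ∪ openConn a c) ∩ (openConn a c ∪ openConn b c)) =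
      PrW Finset.univ (fun e => (w e : ℝ)) (evT (![a, b, c, y]) fun t => alphaTarget.EA t && alphaTarget.EB t) :=
    prodBernoulli_real_eq_PrW_univ w fun S => by
      have h := M S; simp only [evT, Set.mem_setOf_eq, Bool.and_eq_true] at h ⊢
      rw [Set.mem_inter_iff, ← h.1, ← h.2.1]
  rw [t1, tA, tB, tC, tBC, tAC, tAB]
  linarith [key]

end Bridge

end FourCopyHub

end Summit.CriticalPhenomena.PercolationContinuityZ3.Theorems

end
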